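import Literature.NumberTheory.Sieve.FordMaynardFramework
import Mathlib.Analysis.SpecialFunctions.Integrals.Basic
import HarnessLib

/-!
# Ford–Maynard slice integrals in dimension two: the normalisation, and one cell in closed form

Topic `Literature/NumberTheory/Sieve`; a small PROVED complement to `FordMaynardFramework.lean`
(`sliceIntegral`, Ford–Maynard arXiv:2407.14368 §4.2, "Notational convention": integrals over
`{u ∈ (0,∞)^d : u₁ + ⋯ + u_d = w}` are taken with respect to the projection measure onto the first
`d − 1` coordinates).

* `sliceIntegral_two`: in dimension `2` the slice `{u₁ + u₂ = w}` is parametrised by the first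
  coordinate and `∫_{u ∈ (0,∞)², u₁+u₂ = w} G(u) = ∫_{0 < t < w} G(t, w − t) dt` — no surface-measure
  factor `√2`, no ordering factor; this is the normalisation in which the `k = 2` term of
  Theorem 7.3 (a) / Theorem 2.7 (a) (`∫ dβ₁/(β₁β₂)`-type integrals over `β₁ + β₂ = 1`) is read.
* `sliceIntegral_two_orderedBox`: the `k = 2` summand of Theorem 7.3 (a) at `P = (1/2, 0, ν)`
  (integrand `𝟙[ν < xᵢ < 1−ν, x₁ ≤ x₂] F(x)/(x₁x₂)`, cf. `sieveBoundG1`) as the plain integral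
  `∫_{0<t<1} 𝟙[ν < t < 1−ν, t ≤ 1−t] F(t,1−t)/(t(1−t)) dt`.
* `sliceIntegral_two_indicator_div_mul`: the one-cell value
  `∫_{u₁+u₂=1} 𝟙[a < u₁ < b]/(u₁u₂) = log(b/(1−b)) − log(a/(1−a))` for `0 < a ≤ b < 1`
  (the antiderivative of `1/(t(1−t))` is `log t − log(1−t)`), i.e. the contribution of a constant
  piece of a piecewise-constant `g` to the `k = 2` term of `V(ν, g)` in `FordMaynardSieveBoundG1`.

## References

* K. Ford, J. Maynard, *On the theory of prime producing sieves*, arXiv:2407.14368 (2024), §4.2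
  (Notational convention), Theorem 2.7 (a), Theorem 7.3 (a). [FordMaynard2024PrimeSieves]
-/

noncomputable section

open MeasureTheory Set

namespace Literature.NumberTheory.Sieve.FordMaynard

/-- For `u : Fin 1 → ℝ`, appending `s` gives the vector `(u 0, s)`. [folklore] -/
private theorem snoc_fin_one (u : Fin 1 → ℝ) (s : ℝ) :
    (Fin.snoc u s : Fin 2 → ℝ) = ![u 0, s] := by
  ext i
  fin_cases i
  · rfl
  · rfl

/-- **Dimension two: the slice integral is a one-dimensional integral.** For every `w` and every
`G : ℝ² → ℝ`, `∫_{u ∈ (0,∞)², u₁ + u₂ = w} G(u) du = ∫_{t ∈ (0, w)} G(t, w − t) dt` (projection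
measure onto the first coordinate; for `w ≤ 0` both sides vanish).
[cite: FordMaynard2024PrimeSieves, §4.2 (Notational convention)] -/
theorem sliceIntegral_two (w : ℝ) (G : (Fin 2 → ℝ) → ℝ) :
    sliceIntegral 2 w G = ∫ t in Ioo 0 w, G ![t, w - t] := by
  -- unfold: the integration variable is `u : Fin 1 → ℝ`
  show (∫ u : Fin 1 → ℝ,
      (if (∀ i, 0 < u i) ∧ ∑ i, u i < w then G (Fin.snoc u (w - ∑ i, u i)) else 0)) = _
  -- the integrand depends on `u` only through `u 0 = funUnique u`
  set g : ℝ → ℝ := fun t => if 0 < t ∧ t < w then G ![t, w - t] else 0 with hg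
  have hcomp : (fun u : Fin 1 → ℝ =>
      (if (∀ i, 0 < u i) ∧ ∑ i, u i < w then G (Fin.snoc u (w - ∑ i, u i)) else 0)) =
      fun u => g (MeasurableEquiv.funUnique (Fin 1) ℝ u) := by
    funext u
    have h0 : (MeasurableEquiv.funUnique (Fin 1) ℝ u : ℝ) = u 0 := rfl
    simp only [hg, h0, Fin.forall_fin_one, Fin.sum_univ_one, snoc_fin_one]
  rw [hcomp]
  refine ((volume_preserving_funUnique (Fin 1) ℝ).integral_comp'
    (f := MeasurableEquiv.funUnique (Fin 1) ℝ) g).trans ?_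
  -- `∫ g = ∫_{(0,w)} G(t, w−t)`
  have hind : g = (Ioo 0 w).indicator fun t => G ![t, w - t] := by
    funext t
    simp only [hg, Set.indicator_apply, mem_Ioo]
  rw [hind, integral_indicator measurableSet_Ioo]

/-- The components of `![t, s]`. [folklore] -/
private theorem vec2_zero (t s : ℝ) : (![t, s] : Fin 2 → ℝ) 0 = t := rfl

/-- The components of `![t, s]`. [folklore] -/
private theorem vec2_one (t s : ℝ) : (![t, s] : Fin 2 → ℝ) 1 = s := rfl

/-- `∏ᵢ (t, s)ᵢ = t s`. [folklore] -/
private theorem prod_univ_vec2 (t s : ℝ) : ∏ i, (![t, s] : Fin 2 → ℝ) i = t * s := by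
  rw [Fin.prod_univ_two]
  rfl

/-- A coordinatewise predicate on `(t, s)`. [folklore] -/
private theorem forall_vec2_iff (P : ℝ → Prop) (t s : ℝ) :
    (∀ i, P ((![t, s] : Fin 2 → ℝ) i)) ↔ P t ∧ P s := by
  rw [Fin.forall_fin_two]
  rfl

/-- `(t, s)` is non-decreasing iff `t ≤ s` (the ordered cone in dimension `2`). [folklore] -/
private theorem monotone_vec2_iff (t s : ℝ) : Monotone (![t, s] : Fin 2 → ℝ) ↔ t ≤ s := by
  constructor
  · intro h
    exact h (show (0 : Fin 2) ≤ 1 from Fin.zero_le _)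
  · intro h i j hij
    fin_cases i <;> fin_cases j
    · exact le_rfl
    · exact h
    · exact absurd hij (by decide)
    · exact le_rfl

/-- **The `k = 2` term of a level-`1/2` sieve bound as a one-dimensional integral.** For any `ν` and
any `F : ℝ² → ℝ`, the slice integral over `{x₁ + x₂ = 1}` of
`𝟙[ν < xᵢ < 1 − ν ∀ i, x₁ ≤ x₂] · F(x)/(x₁x₂)` — the shape of the `k = 2` summand of the right-hand side
of Theorem 7.3 (a) at `P = (1/2, 0, ν)` (`sieveBoundG1` in `FordMaynardSieveBoundG1.lean`, with
`F = 𝟙 ⋆ g`) — equals `∫_{0<t<1} 𝟙[ν < t < 1 − ν, t ≤ 1 − t] F(t, 1−t)/(t(1−t)) dt`.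
[cite: FordMaynard2024PrimeSieves, Theorem 7.3 (a) and §4.2 (Notational convention)] -/
theorem sliceIntegral_two_orderedBox (ν : ℝ) (F : (Fin 2 → ℝ) → ℝ) :
    sliceIntegral 2 1
        (fun x => if (∀ i, ν < x i ∧ x i < 1 - ν) ∧ Monotone x then F x / ∏ i, x i else 0) =
      ∫ t in Ioo 0 1,
        if (ν < t ∧ t < 1 - ν) ∧ t ≤ 1 - t then F ![t, 1 - t] / (t * (1 - t)) else 0 := by
  rw [sliceIntegral_two]
  refine setIntegral_congr_fun measurableSet_Ioo fun t _ => ?_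
  simp only [forall_vec2_iff (fun y => ν < y ∧ y < 1 - ν), monotone_vec2_iff, prod_univ_vec2]
  have hiff : ((ν < t ∧ t < 1 - ν) ∧ (ν < 1 - t ∧ 1 - t < 1 - ν)) ∧ t ≤ 1 - t ↔
      (ν < t ∧ t < 1 - ν) ∧ t ≤ 1 - t := by
    constructor
    · rintro ⟨⟨h1, _⟩, h3⟩
      exact ⟨h1, h3⟩
    · rintro ⟨⟨h1, h2⟩, h3⟩
      exact ⟨⟨⟨h1, h2⟩, by linarith, by linarith⟩, h3⟩
  exact if_congr hiff rfl rfl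

/-- The antiderivative of `1/(t(1−t))` on `(0,1)`: `d/dt (log t − log(1−t)) = 1/(t(1−t))`.
[folklore] -/
private theorem hasDerivAt_log_sub_log_oneSub {t : ℝ} (ht0 : 0 < t) (ht1 : t < 1) :
    HasDerivAt (fun x => Real.log x - Real.log (1 - x)) (1 / (t * (1 - t))) t := by
  have ht0' : t ≠ 0 := ht0.ne'
  have ht1' : (1 : ℝ) - t ≠ 0 := by linarith
  have h1 : HasDerivAt (fun x : ℝ => Real.log x) t⁻¹ t := Real.hasDerivAt_log ht0'
  have h2 : HasDerivAt (fun x : ℝ => Real.log (1 - x)) (-1 / (1 - t)) t :=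
    ((hasDerivAt_id' t).const_sub 1).log ht1'
  have h := h1.sub h2
  refine h.congr_deriv ?_
  field_simp
  ring

/-- **One cell of the `k = 2` slice, in closed form.** For `0 < a ≤ b < 1`,
`∫_{u ∈ (0,∞)², u₁ + u₂ = 1} 𝟙[a < u₁ < b] /(u₁ u₂) du = log(b/(1−b)) − log(a/(1−a))`: on the slice
`u₂ = 1 − u₁`, and `∫_a^b dt/(t(1−t)) = [log t − log(1 − t)]_a^b`. This is the value of one constant
piece (height `1` on `a < x₁ < b`) in the `k = 2` term `∫_{x₁+x₂=1} (𝟙⋆g)(x)/(x₁x₂)` of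
Theorem 7.3 (a). [cite: FordMaynard2024PrimeSieves, Theorem 7.3 (a) and §4.2 (Notational convention)] -/
theorem sliceIntegral_two_indicator_div_mul {a b : ℝ} (ha : 0 < a) (hab : a ≤ b) (hb : b < 1) :
    sliceIntegral 2 1 (fun x => if a < x 0 ∧ x 0 < b then 1 / (x 0 * x 1) else 0) =
      Real.log (b / (1 - b)) - Real.log (a / (1 - a)) := by
  rw [sliceIntegral_two]
  simp only [vec2_zero, vec2_one]
  -- restrict from `(0,1)` to `(a,b)`
  have hsub : Ioo a b ⊆ Ioo (0:ℝ) 1 := fun t ht => ⟨ha.trans ht.1, ht.2.trans hb⟩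
  have h1 : (∫ t in Ioo (0:ℝ) 1, if a < t ∧ t < b then 1 / (t * (1 - t)) else 0) =
      ∫ t in Ioo a b, 1 / (t * (1 - t)) := by
    have hind : (fun t : ℝ => if a < t ∧ t < b then 1 / (t * (1 - t)) else 0) =
        (Ioo a b).indicator fun t => 1 / (t * (1 - t)) := by
      funext t
      simp only [Set.indicator_apply, mem_Ioo]
    rw [hind, setIntegral_indicator measurableSet_Ioo, Set.inter_eq_self_of_subset_right hsub]
  rw [h1, ← integral_Ioc_eq_integral_Ioo, ← intervalIntegral.integral_of_le hab]
  -- fundamental theorem of calculus on `[a, b] ⊆ (0, 1)`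
  have hcont : ContinuousOn (fun t : ℝ => 1 / (t * (1 - t))) (uIcc a b) := by
    refine continuousOn_const.div (continuousOn_id.mul (continuousOn_const.sub continuousOn_id))
      fun t ht => ?_
    rw [uIcc_of_le hab] at ht
    have h0 : 0 < t := ha.trans_le ht.1
    have h1' : t < 1 := ht.2.trans_lt hb
    exact mul_ne_zero h0.ne' (by linarith)
  rw [intervalIntegral.integral_eq_sub_of_hasDerivAt (f := fun x => Real.log x - Real.log (1 - x))
    (fun t ht => by
      rw [uIcc_of_le hab] at ht
      exact hasDerivAt_log_sub_log_oneSub (ha.trans_le ht.1) (ht.2.trans_lt hb))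
    (hcont.intervalIntegrable)]
  have ha1 : (0:ℝ) < 1 - a := by linarith
  have hb0 : (0:ℝ) < b := ha.trans_le hab
  have hb1 : (0:ℝ) < 1 - b := by linarith
  rw [Real.log_div hb0.ne' hb1.ne', Real.log_div ha.ne' ha1.ne']

end Literature.NumberTheory.Sieve.FordMaynard
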